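import Mathlib
import Literature.Probability.LatticeModels.BoxDirichlet
import Literature.Probability.LatticeModels.DomainDiscretisation
import Literature.Probability.LatticeModels.AnnulusManeuver
import Literature.Probability.LatticeModels.WeakBeurlingEstimate
import HarnessLib

/-!
# Oriented frames on `ℤ²`: reducing the four axis directions to "domain above the boundary row"

Topic `Literature/Probability/LatticeModels` (bookkeeping for lattice potential theory near a flat
piece of boundary). The lattice estimates of `RectangleSideHarmonicMeasure.lean` and
`BoundaryPoleGreenBounds.lean` (Chelkak–Smirnov's Lemma 3.12, the window comparison, the Harnack
corridor) are written for ONE orientation: the discrete domain lies in the rows ABOVE a killed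
row. At a flat boundary point of a rectilinear domain the domain may lie above, below, to the
right or to the left of the boundary line; the Green function is invariant under the symmetries
of the square lattice (`dirichletGreen_map_motion`), so it suffices to conjugate by a lattice
motion sending the inward normal to "up". This file fixes that bookkeeping once:

* `Orient` — the four orientations `up | down | right | left` ("the domain lies on that side");
* `Orient.frame o : Site 2 ≃ Site 2` — the motion `(i,j) ↦ (i,j) | (i,-j) | (j,i) | (j,-i)`
  sending orientation `o` to `up`; `frame_apply_zero/one` : its coordinates are the tangential
  and normal coordinates `Orient.tng o v`, `Orient.nrm o v`; `isLatticeMotion_frame`;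
* `mem_mW_frame_iff`, `mem_mB_frame_iff`, `mem_sqBox_frame_iff` — sup-norm boxes are carried to
  sup-norm boxes (`z ∈ mW (frame o c) k ↔ (frame o)⁻¹ z ∈ mW c k`);
* the plane counterparts `Orient.nrmC o p`, `Orient.tngC o p` (`= ±Im p, ±Re p`), the inward
  normal `Orient.ν o ∈ {i, -i, 1, -1}` and tangent `Orient.e o ∈ {1, i}` with
  `p = tngC o p · e o + nrmC o p · ν o` (`tngC_mul_e_add_nrmC_mul_ν`), `nrmC_meshPoint`,
  `tngC_meshPoint` (`nrmC o (meshPoint δ v) = δ · nrm o v`), `abs_nrmC_sub_le_norm`,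
  `abs_tngC_sub_le_norm`, `norm_ν`, `norm_e`, and `meshPoint_frame_symm`
  (`meshPoint δ ((frame o)⁻¹ z') = meshPoint δ b + δ((z'₀ - (frame o b)₀) e + (z'₁ - (frame o b)₁) ν)`).

Everything is proved, [folklore].
-/

noncomputable section

namespace Literature.Probability.LatticeModels

open _root_.Complex Metric Set

/-- The four orientations of a flat piece of boundary: the domain lies `up` (above), `down`,
`right` or `left` of the boundary line. [folklore] -/
inductive Orient
  | up | down | right | left
  deriving DecidableEq

namespace Orient

/-- The lattice motion straightening orientation `o` to `up`:
`(i,j) ↦ (i,j) | (i,-j) | (j,i) | (j,-i)`. [folklore] -/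
def frame : Orient → (Site 2 ≃ Site 2)
  | up => Equiv.refl _
  | down =>
    { toFun := fun v => ![v 0, -v 1], invFun := fun v => ![v 0, -v 1],
      left_inv := fun v => by ext i; fin_cases i <;> simp,
      right_inv := fun v => by ext i; fin_cases i <;> simp }
  | right =>
    { toFun := fun v => ![v 1, v 0], invFun := fun v => ![v 1, v 0],
      left_inv := fun v => by ext i; fin_cases i <;> simp,
      right_inv := fun v => by ext i; fin_cases i <;> simp }
  | left =>
    { toFun := fun v => ![v 1, -v 0], invFun := fun v => ![-v 1, v 0],
      left_inv := fun v => by ext i; fin_cases i <;> simp,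
      right_inv := fun v => by ext i; fin_cases i <;> simp }

/-- The tangential lattice coordinate in orientation `o`. [folklore] -/
def tng : Orient → Site 2 → ℤ
  | up, v => v 0 | down, v => v 0 | right, v => v 1 | left, v => v 1

/-- The (inward) normal lattice coordinate in orientation `o`. [folklore] -/
def nrm : Orient → Site 2 → ℤ
  | up, v => v 1 | down, v => -v 1 | right, v => v 0 | left, v => -v 0

/-- First frame coordinate = tangential coordinate. [folklore] -/
@[simp] theorem frame_apply_zero (o : Orient) (v : Site 2) : frame o v 0 = tng o v := by
  cases o <;> rfl

/-- Second frame coordinate = normal coordinate. [folklore] -/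
@[simp] theorem frame_apply_one (o : Orient) (v : Site 2) : frame o v 1 = nrm o v := by
  cases o <;> rfl

/-- `tng` is additive. [folklore] -/
theorem tng_sub (o : Orient) (v w : Site 2) : tng o (v - w) = tng o v - tng o w := by
  cases o <;> simp [tng]

/-- `nrm` is additive. [folklore] -/
theorem nrm_sub (o : Orient) (v w : Site 2) : nrm o (v - w) = nrm o v - nrm o w := by
  cases o <;> simp [nrm] <;> ring

/-- The sup-norm is preserved: `{|tng|, |nrm|} = {|v₀|, |v₁|}`. [folklore] -/
theorem abs_tng_abs_nrm (o : Orient) (v : Site 2) :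
    (|tng o v| = |v 0| ∧ |nrm o v| = |v 1|) ∨ (|tng o v| = |v 1| ∧ |nrm o v| = |v 0|) := by
  cases o <;> simp [tng, nrm, abs_neg]

/-- The frame is a lattice motion. [folklore] -/
theorem isLatticeMotion_frame (o : Orient) : IsLatticeMotion (frame o) := by
  cases o
  · exact ⟨Equiv.refl _, fun x k => by simp [frame]⟩
  · refine ⟨Equiv.swap 1 3, fun x k => ?_⟩
    fin_cases k <;> ext i <;> fin_cases i <;>
      simp [frame, cornerUnit, Equiv.swap_apply_of_ne_of_ne, Equiv.swap_apply_left,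
        Equiv.swap_apply_right] <;> ring
  · refine ⟨(Equiv.swap 0 1).trans (Equiv.swap 2 3), fun x k => ?_⟩
    fin_cases k <;> ext i <;> fin_cases i <;>
      simp [frame, cornerUnit, Equiv.swap_apply_of_ne_of_ne, Equiv.swap_apply_left,
        Equiv.swap_apply_right, Equiv.trans_apply]
  · refine ⟨(Equiv.swap 0 1).trans ((Equiv.swap 2 3).trans (Equiv.swap 1 3)), fun x k => ?_⟩
    fin_cases k <;> ext i <;> fin_cases i <;>
      simp [frame, cornerUnit, Equiv.swap_apply_of_ne_of_ne, Equiv.swap_apply_left,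
        Equiv.swap_apply_right, Equiv.trans_apply] <;> ring

/-! ### Sup-norm boxes under the frame -/

/-- A sup-norm box condition is symmetric under exchanging/negating coordinates: membership of
`frame o x` in the box about `frame o c` is membership of `x` in the box about `c`. [folklore] -/
theorem abs_frame_sub_le_iff (o : Orient) (x c : Site 2) (R : ℤ) :
    (|frame o x 0 - frame o c 0| ≤ R ∧ |frame o x 1 - frame o c 1| ≤ R) ↔
      (|x 0 - c 0| ≤ R ∧ |x 1 - c 1| ≤ R) := by
  cases o <;> simp only [frame_apply_zero, frame_apply_one, tng, nrm]
  · rw [show -x 1 - -c 1 = -(x 1 - c 1) by ring, abs_neg]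
  · exact And.comm
  · rw [show -x 0 - -c 0 = -(x 0 - c 0) by ring, abs_neg]; exact And.comm

/-- `z ∈ mW (frame o c) k ↔ (frame o)⁻¹ z ∈ mW c k`. [folklore] -/
theorem mem_mW_frame_iff (o : Orient) (c z : Site 2) (k : ℕ) :
    z ∈ mW (frame o c) k ↔ (frame o).symm z ∈ mW c k := by
  conv_lhs => rw [← (frame o).apply_symm_apply z]
  exact abs_frame_sub_le_iff o _ c _

/-- `z ∈ mB (frame o c) k ↔ (frame o)⁻¹ z ∈ mB c k`. [folklore] -/
theorem mem_mB_frame_iff (o : Orient) (c z : Site 2) (k : ℕ) :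
    z ∈ mB (frame o c) k ↔ (frame o).symm z ∈ mB c k := by
  conv_lhs => rw [← (frame o).apply_symm_apply z]
  exact abs_frame_sub_le_iff o _ c _

/-- `z ∈ sqBox (frame o p) n ↔ (frame o)⁻¹ z ∈ sqBox p n`. [folklore] -/
theorem mem_sqBox_frame_iff (o : Orient) (p z : Site 2) (n : ℤ) :
    z ∈ WeakBeurling.sqBox (frame o p) n ↔ (frame o).symm z ∈ WeakBeurling.sqBox p n := by
  conv_lhs => rw [← (frame o).apply_symm_apply z]
  exact abs_frame_sub_le_iff o _ p _

/-- The image of a box: `frame o x ∈ mB (frame o c) k ↔ x ∈ mB c k`. [folklore] -/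
theorem frame_mem_mB_iff (o : Orient) (c x : Site 2) (k : ℕ) :
    frame o x ∈ mB (frame o c) k ↔ x ∈ mB c k := by
  rw [mem_mB_frame_iff, Equiv.symm_apply_apply]

/-- The image of a box: `frame o x ∈ mW (frame o c) k ↔ x ∈ mW c k`. [folklore] -/
theorem frame_mem_mW_iff (o : Orient) (c x : Site 2) (k : ℕ) :
    frame o x ∈ mW (frame o c) k ↔ x ∈ mW c k := by
  rw [mem_mW_frame_iff, Equiv.symm_apply_apply]

/-! ### The plane counterparts -/

/-- Normal coordinate of a point of the plane in orientation `o` (`Im, -Im, Re, -Re`). [folklore] -/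
def nrmC : Orient → ℂ → ℝ
  | up, p => p.im | down, p => -p.im | right, p => p.re | left, p => -p.re

/-- Tangential coordinate of a point of the plane in orientation `o` (`Re, Re, Im, Im`). [folklore] -/
def tngC : Orient → ℂ → ℝ
  | up, p => p.re | down, p => p.re | right, p => p.im | left, p => p.im

/-- The inward unit normal (`i, -i, 1, -1`). [folklore] -/
def ν : Orient → ℂ
  | up => I | down => -I | right => 1 | left => -1

/-- The unit tangent (`1, 1, i, i`). [folklore] -/
def e : Orient → ℂ
  | up => 1 | down => 1 | right => I | left => I

/-- `|ν| = 1`. [folklore] -/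
@[simp] theorem norm_ν (o : Orient) : ‖ν o‖ = 1 := by cases o <;> simp [ν]

/-- `|e| = 1`. [folklore] -/
@[simp] theorem norm_e (o : Orient) : ‖e o‖ = 1 := by cases o <;> simp [e]

/-- Decomposition of a point along tangent and normal. [folklore] -/
theorem tngC_mul_e_add_nrmC_mul_ν (o : Orient) (p : ℂ) :
    (tngC o p : ℂ) * e o + (nrmC o p : ℂ) * ν o = p := by
  cases o <;> apply Complex.ext <;> simp [tngC, nrmC, e, ν]

/-- `nrmC` is real-linear (difference). [folklore] -/
theorem nrmC_sub (o : Orient) (p q : ℂ) : nrmC o (p - q) = nrmC o p - nrmC o q := by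
  cases o <;> simp [nrmC] <;> ring

/-- `tngC` is real-linear (difference). [folklore] -/
theorem tngC_sub (o : Orient) (p q : ℂ) : tngC o (p - q) = tngC o p - tngC o q := by
  cases o <;> simp [tngC]

/-- `nrmC` of a tangent/normal combination. [folklore] -/
theorem nrmC_combo (o : Orient) (s t : ℝ) : nrmC o ((s : ℂ) * e o + (t : ℂ) * ν o) = t := by
  cases o <;> simp [nrmC, e, ν]

/-- `tngC` of a tangent/normal combination. [folklore] -/
theorem tngC_combo (o : Orient) (s t : ℝ) : tngC o ((s : ℂ) * e o + (t : ℂ) * ν o) = s := by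
  cases o <;> simp [tngC, e, ν]

/-- `|nrmC p| ≤ |p|`. [folklore] -/
theorem abs_nrmC_le_norm (o : Orient) (p : ℂ) : |nrmC o p| ≤ ‖p‖ := by
  cases o <;> simp [nrmC, abs_re_le_norm, abs_im_le_norm, abs_neg]

/-- `|tngC p| ≤ |p|`. [folklore] -/
theorem abs_tngC_le_norm (o : Orient) (p : ℂ) : |tngC o p| ≤ ‖p‖ := by
  cases o <;> simp [tngC, abs_re_le_norm, abs_im_le_norm]

/-- `|nrmC p - nrmC q| ≤ |p - q|`. [folklore] -/
theorem abs_nrmC_sub_le_norm (o : Orient) (p q : ℂ) : |nrmC o p - nrmC o q| ≤ ‖p - q‖ := by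
  rw [← nrmC_sub]; exact abs_nrmC_le_norm o _

/-- `|tngC p - tngC q| ≤ |p - q|`. [folklore] -/
theorem abs_tngC_sub_le_norm (o : Orient) (p q : ℂ) : |tngC o p - tngC o q| ≤ ‖p - q‖ := by
  rw [← tngC_sub]; exact abs_tngC_le_norm o _

/-- `|p| ≤ |tngC p| + |nrmC p|`. [folklore] -/
theorem norm_le_abs_tngC_add_abs_nrmC (o : Orient) (p : ℂ) : ‖p‖ ≤ |tngC o p| + |nrmC o p| := by
  have h := norm_le_abs_re_add_abs_im p
  cases o <;> simp [tngC, nrmC, abs_neg] <;> linarith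

/-- Normal coordinate of a mesh point: `nrmC o (meshPoint δ v) = δ · nrm o v`. [folklore] -/
theorem nrmC_meshPoint (o : Orient) (δ : ℝ) (v : Site 2) :
    nrmC o (meshPoint δ v) = δ * nrm o v := by
  cases o <;> simp [nrmC, nrm, meshPoint_re, meshPoint_im]

/-- Tangential coordinate of a mesh point: `tngC o (meshPoint δ v) = δ · tng o v`. [folklore] -/
theorem tngC_meshPoint (o : Orient) (δ : ℝ) (v : Site 2) :
    tngC o (meshPoint δ v) = δ * tng o v := by
  cases o <;> simp [tngC, tng, meshPoint_re, meshPoint_im]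

/-- **Mesh points in frame coordinates.** For a site `z'` given in the frame of `o`,
`meshPoint δ ((frame o)⁻¹ z') = meshPoint δ b + δ((z'₀ - (frame o b)₀)·e + (z'₁ - (frame o b)₁)·ν)`.
[folklore] -/
theorem meshPoint_frame_symm (o : Orient) (δ : ℝ) (b z' : Site 2) :
    meshPoint δ ((frame o).symm z') = meshPoint δ b +
      (δ : ℂ) * ((((z' 0 - frame o b 0 : ℤ) : ℝ) : ℂ) * e o + (((z' 1 - frame o b 1 : ℤ) : ℝ) : ℂ) * ν o) := by
  set z := (frame o).symm z' with hz
  have hz' : z' = frame o z := by rw [hz, Equiv.apply_symm_apply]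
  rw [hz', frame_apply_zero, frame_apply_one, frame_apply_zero, frame_apply_one]
  have key : meshPoint δ z - meshPoint δ b =
      (δ : ℂ) * ((((tng o z - tng o b : ℤ) : ℝ) : ℂ) * e o + (((nrm o z - nrm o b : ℤ) : ℝ) : ℂ) * ν o) := by
    have h1 := tngC_mul_e_add_nrmC_mul_ν o (meshPoint δ z - meshPoint δ b)
    rw [tngC_sub, nrmC_sub, tngC_meshPoint, tngC_meshPoint, nrmC_meshPoint, nrmC_meshPoint] at h1
    rw [← h1]; push_cast; ring
  rw [← key]; ring

end Orient

end Literature.Probability.LatticeModels
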